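import Literature.MathematicalPhysics.QuantumFieldTheory.Balaban1983to89.B7Prop6General
import Literature.MathematicalPhysics.QuantumFieldTheory.Balaban1983to89.B7Prop4GeneralLevels
import Literature.MathematicalPhysics.QuantumFieldTheory.Balaban1983to89.B7Eq123General

/-!
# `Balaban1983to89.B7Prop6GeneralLevels` — T. Bałaban, *Averaging operations for lattice gauge theories*, Commun. Math. Phys.
**98** (1985) 17–51 [Balaban1985Averaging], Sect. E, Proposition 6 (164) p. 43 AT A GENERAL BACKGROUND — the input (161)
"From Proposition 4, and especially from (131), we get `|(1/i) log U̿′ʲ| = |Q_j(U₀, ηA′)| < 2α₁Lʲη`" SUPPLIED from the tree's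
Proposition 4 at a general background (`B7Prop4GeneralLevels.prop4_general_of_prop3`, under its displayed Prop.-3 binders), and the
identification `U̿′ʲ = e^{Q_j(U₀, ηA′)}` of the covariant double-bar iterates (90)/(91) with the composites (127)

statement-level skeleton of published theorems with citation tags; proofs where landed; nothing here is a claim about the Yang–Mills mass gap

PDF held: `paper:balaban1985-cmp98-averaging` (journal page = PDF page + 16); renders `…/1985-cmp98-averaging-p021/p022-x2.png`
(pp. 37–38) and `p026/p027-x2.png` (pp. 42–43), read as images by the unit.

CITATION HEADER (lean-in-tree rule).  Cell `lit-balaban` (HOME `run/shared/lean/pub/lit-balaban/`), unit `lit-balaban-r04` (B7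
reader/typer, gen 3), companion of the announced build `B7Prop6General` (HOME/STATUS.md 2026-08-21) — KERNEL PIECES for SKELETON
rows `B7.Prop6`/`B7.Eq159` ((161) ⇒ (164) at a general background) and `B7.Eq127` (the identity `U̿₁ʲ = exp Q_j(U₀, ηA)` for the
composites `logCovIter`).  Nothing of the abstract carrier `B7.lean` is instantiated.

PRINT.  p. 37 (127): "`Q_k(U₀, ηA) = Q(Ū₀^{k−1}, Q(Ū₀^{k−2}, … Q(U₀, ηA)…))`"; p. 36 (121): "`Q(V₀, A, c) = (1/i) log(V̿₁)_c`";
p. 38 (131): "`|(Lʲη)⁻¹Q_j(U₀, ηA)| < e^{O(1)2α₀}(1 + 8C₁α₁)α₁ < 2α₁`"; p. 42 (161) and p. 43 Proposition 6 (164) as quoted in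
`B7Prop6General`/`B7Prop6Flat`.

WHAT THIS FILE PROVES (kernel, no `sorry`, standard axioms).
* §1 **`dbavgCovIter_eq_expCfg_logCovIter`** — the identification `U̿′ʲ = e^{Q_j}` ((90)/(91) vs (127): `B7Eq92Concrete.dbavgCovIter L
  U₀ (expCfg B) j = expCfg (B7Prop4GeneralLevels.logCovIter L U₀ B j)`) for all `j ≤ k`, under DISPLAYED level hypotheses: the averaged
  backgrounds `Ū₀ʲ` (`j < k`) unit-bounded with plaquette deviation `pdev Ū₀ʲ ≤ β`, `1024(d+1)(d+4)L²β ≤ 1`, and the (131)-bounds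
  `‖Q_j‖ ≤ 2Lʲb` (`j < k`) with `256(d+1)Lᵏb ≤ 1` — each one-step double-bar average then lies in the disc of the logarithm
  (`B7Prop3GeneralAnalytic.logDomainCov_lt`, block contours of `Ū₀ʲ` regular by `B7Prop2Explicit.norm_Wcx_sub_one_le`), so `exp ∘ log = id`.
* §2 **`prop6_general_of_prop3`** — **Proposition 6 (164) AT A GENERAL BACKGROUND, k-UNIFORM, `O(1) = 200(d+1)`, under (52) and the three
  displayed Prop.-3 binders `h3rem`/`h3lin`/`h3sub` of `B7Prop4GeneralLevels.prop4_general_of_prop3`** (the same epistemic status as the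
  tree's Prop. 4 at a general background; `h3lin` is discharged in `B7Prop3GeneralLinearPdev`): (131) from `prop4_general_of_prop3`, level
  regularity from `B7Prop4GeneralLevels.level_regularity` (Prop. 2), §1, and `B7Prop6General.prop6_general`.
* §3 (v1.1) **`prop6_general_unconditional`**, **`eq164_general_unconditional`** — **PROPOSITION 6 (159)/(161)/(163)/(164) AT A
  GENERAL BACKGROUND, k-UNIFORM, `O(1) = 200(d+1)`, UNCONDITIONAL**: the hypotheses are those of `B7Eq123General.prop4_general`
  verbatim (seat p06's Literature-side certification of (123) and of Prop. 4 (130)–(131) at a general background: `G`-valued `U₀`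
  with (52), `C₀α₀ ≤ ⅓`, `4α₀ ≤ c₂′`, `sup‖B‖ ≤ b`, `e^{4cα₀}(1 + 8C₁Lᵏb) ≤ 2`, `2Lᵏb ≤ c₃(d,L)`); the threshold `8C₁(d)Lᵏb ≤ 1`
  of `B7Prop6General.prop6_general` follows from that smallness.  (p06's `B7Eq123General.dbavgCovIter_eq_expCfg_logCovIter` is
  the (52)-currency form of §1 and is the one used in §3; §1 stays as the displayed-level-hypotheses form.)
READINGS: those of `B7Prop6General` ((a) `U1`/Banach reading, (c) the threshold `8C₁(d)Lᵏb ≤ 1`) and of `B7Prop4GeneralLevels` (the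
binders, `C₁, c₃, c, βmax` abstract constants of Prop. 3 at a general background); extra explicit smallness here: `2048(d+1)(d+4)L²α₀ ≤ 1`
(level regularity within `1/64`) and `256(d+1)Lᵏb ≤ 1` (§2 only).  NOT CLAIMED: the analyticity clause of Prop. 6 at a general
background (@flat: `B7Prop6Flat.prop6_flat_analyticAt`).
DECLARATIONS: theorems only; imports `B7Prop6General`, `B7Prop4GeneralLevels`, `B7Eq123General` (v1.1); REUSED BY NAME:
`B7Eq123General.prop4_general, level_data, dbavgCovIter_eq_expCfg_logCovIter` (§3), `B7Prop6General.prop6_general`,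
`B7Prop4GeneralLevels.logCovIter, logCovIter_succ, prop4_general_of_prop3, level_regularity`, `B7Prop3GeneralLinear.Qcov`,
`B7Prop3GeneralAnalytic.logDomainCov_lt`, `B7Prop2Explicit.norm_Wcx_sub_one_le, le_pdev, avgIter, pdev, AvgClosed, C0, c2'`,
`B7Eq92Concrete.dbavgCovIter, dbavgCovIter_succ`, `B7Prop3Flat.expCfg, C1`, `MatrixLog.exp_mlog`.
Unit `lit-balaban-r04` (gen 3), 2026-08-21; v1.1 (§3, unconditional form) same day after p246433 `B7Eq123General` landed.

[cite: Balaban1985Averaging, Proposition 6 (164) p.43, (161) p.42, (127) p.37, (131) p.38, (90)–(91) p.31, (121) p.36, (52) p.26]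
-/

noncomputable section

open NormedSpace Finset

namespace Literature.MathematicalPhysics.QuantumFieldTheory.Balaban1983to89.B7Prop6GeneralLevels

open B7Prop1Explicit B7Prop2Explicit B7Prop3Flat MatrixLog B7Eq92Concrete B7Prop3GeneralAnalytic B7Prop3GeneralLinear
  B7Prop4GeneralLevels B7Prop6General

-- `Site` alone would resolve to the torus sites of `Setup.lean`; re-export the `ℤ^d` sites of `B7Prop1Explicit`.
export B7Prop1Explicit (Site)

variable {d : ℕ}

variable {𝔸 : Type*} [NormedRing 𝔸] [NormedAlgebra ℂ 𝔸] [CompleteSpace 𝔸] [NormOneClass 𝔸]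

/-! ## §1 `U̿′ʲ = e^{Q_j(U₀, ηA′)}`: the double-bar iterates are the exponentials of the composites (127) -/

/-- **`U̿′ʲ = e^{Q_j(U₀, ηA′)}` for all `j ≤ k`** — the covariant double-bar iterates (90)/(91) (`B7Eq92Concrete.dbavgCovIter`) of
`U′ = e^{B}` are the bondwise exponentials of the composites (127) `Q_j(U₀, ·)` (`B7Prop4GeneralLevels.logCovIter`, each step being
(121) `Q(V₀, A, c) = (1/i) log(V̿₁)_c` at `V₀ = Ū₀ʲ`), PROVIDED every one-step average met on the way lies in the disc `|W − 1| < 1` of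
the logarithm (21): guaranteed (`B7Prop3GeneralAnalytic.logDomainCov_lt`) by the DISPLAYED level hypotheses — `Ū₀ʲ` (`j < k`)
unit-bounded with `pdev Ū₀ʲ ≤ β`, `1024(d+1)(d+4)L²β ≤ 1` (block contours of `Ū₀ʲ` within `16(d+1)(d+4)L²β ≤ 1/64` of `1`,
`B7Prop2Explicit.norm_Wcx_sub_one_le`), and (131) `‖Q_j‖ ≤ 2Lʲb` (`j < k`) with `256(d+1)Lᵏb ≤ 1`.  (Print uses the identity
tacitly in (159)–(161): "`|(1/i) log U̿′ʲ| = |Q_j(U₀, ηA′)|`".) [cite: Balaban1985Averaging, (127) p.37, (121) p.36, (161) p.42, (90)–(91) p.31] -/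
theorem dbavgCovIter_eq_expCfg_logCovIter {L : ℕ} (hL : 1 ≤ L) {U₀ : Site d → Fin d → 𝔸ˣ} {B : Site d → Fin d → 𝔸}
    {k : ℕ} {b β : ℝ} (hb : 0 ≤ b)
    (hV : ∀ j < k, ∀ (x : Site d) (κ : Fin d), avgIter L U₀ j x κ ∈ U1 𝔸)
    (hβ0 : 0 ≤ β) (hreg : ∀ j < k, pdev (avgIter L U₀ j) ≤ β)
    (hβ : 1024 * ((d : ℝ) + 1) * ((d : ℝ) + 4) * (L : ℝ) ^ 2 * β ≤ 1)
    (h131 : ∀ j < k, ∀ (z : Site d) (κ : Fin d), ‖logCovIter L U₀ B j z κ‖ ≤ 2 * ((L : ℝ) ^ j * b))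
    (hsm : 256 * ((d : ℝ) + 1) * ((L : ℝ) ^ k * b) ≤ 1) :
    ∀ j ≤ k, dbavgCovIter L U₀ (expCfg B) j = expCfg (logCovIter L U₀ B j) := by
  have hL1r : (1 : ℝ) ≤ L := by exact_mod_cast hL
  have hd0 : (0 : ℝ) ≤ d := Nat.cast_nonneg d
  intro j
  induction j with
  | zero => intro _; rfl
  | succ j ih =>
    intro hjk
    have hj : j < k := Nat.lt_of_succ_le hjk
    have hIH := ih hj.le
    funext z κ
    -- the one-step double-bar average at level `j` lies in the disc of the logarithm
    set a : ℝ := 2 * ((L : ℝ) ^ j * b) with ha_def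
    have ha : 0 ≤ a := by positivity
    have ht_mono : (L : ℝ) ^ (j + 1) * b ≤ (L : ℝ) ^ k * b :=
      mul_le_mul_of_nonneg_right (pow_le_pow_right₀ hL1r hj) hb
    have hθ1 : ((2 * (d * L) + L + L : ℕ) : ℝ) * a ≤ 1 / 64 := by
      have e : ((2 * (d * L) + L + L : ℕ) : ℝ) * a = 4 * ((d : ℝ) + 1) * ((L : ℝ) ^ (j + 1) * b) := by
        rw [ha_def, pow_succ]; push_cast; ring
      rw [e]
      have h1 : 4 * ((d : ℝ) + 1) * ((L : ℝ) ^ (j + 1) * b) ≤ 4 * ((d : ℝ) + 1) * ((L : ℝ) ^ k * b) :=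
        mul_le_mul_of_nonneg_left ht_mono (by positivity)
      linarith
    have h44 : ∀ (x : Site d) (κ₁ κ₂ : Fin d), κ₁ ≠ κ₂ →
        ‖((hol (avgIter L U₀ j) x (plaqWord κ₁ κ₂) : 𝔸ˣ) : 𝔸) - 1‖ ≤ β :=
      fun x κ₁ κ₂ _ => (le_pdev (hV j hj) x κ₁ κ₂).trans (hreg j hj)
    have hβ' : 512 * (d + 1) * (d + 4) * (L : ℝ) ^ 2 * β ≤ 1 := by
      have : 0 ≤ ((d : ℝ) + 1) * ((d : ℝ) + 4) * (L : ℝ) ^ 2 * β := by positivity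
      linarith
    have hW : ∀ r : Fin d → Fin L,
        ‖((Wcx L (avgIter L U₀ j) ((L : ℤ) • z) κ (boxVec L r) : 𝔸ˣ) : 𝔸) - 1‖
          ≤ 2 * (8 * (d + 1) * (d + 4) * (L : ℝ) ^ 2 * β) := fun r =>
      norm_Wcx_sub_one_le L hL (avgIter L U₀ j) (hV j hj) hβ0 hβ' h44 _ κ r
    have hα1 : 2 * (8 * (d + 1) * (d + 4) * (L : ℝ) ^ 2 * β) ≤ 1 / 64 := by
      have : 0 ≤ ((d : ℝ) + 1) * ((d : ℝ) + 4) * (L : ℝ) ^ 2 * β := by positivity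
      linarith
    have hD := (logDomainCov_lt hL (hV j hj) (logCovIter L U₀ B j) ha (h131 j hj) le_rfl (by positivity) hθ1
      ((L : ℤ) • z) κ hα1 hW).2.2.2
    rw [dbavgCovIter_succ, hIH]
    show dbavgCov L (avgIter L U₀ j) (expCfg (logCovIter L U₀ B j)) ((L : ℤ) • z) κ =
      expUnit (logCovIter L U₀ B (j + 1) z κ)
    rw [logCovIter_succ]
    exact Units.ext (by rw [val_expUnit, Qcov, exp_mlog hD])

/-! ## §2 Proposition 6 (164) at a general background from Proposition 4 at a general background -/

/-- **PROPOSITION 6 (164) AT A GENERAL BACKGROUND, k-UNIFORM, UNDER (52) AND THE PROP.-3 BINDERS OF THE TREE'S PROPOSITION 4**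
(p. 43: "If `U₀` satisfies (52), then … `|\overline{U′U₀}ᵏ(Ūᵏ₀)⁻¹ − 1| < O(1)α₁`. (164)"; p. 42: "From Proposition 4, and especially
from (131), we get `|(1/i) log U̿′ʲ| = |Q_j(U₀, ηA′)| < 2α₁Lʲη`, (161)").  HYPOTHESES = those of
`B7Prop4GeneralLevels.prop4_general_of_prop3` verbatim (`L ≥ 2`; `G` average-closed; the abstract Prop.-3 constants `C₁, c₃, c, βmax`
with the displayed binders `h3rem` ((123)), `h3lin` ((126)), `h3sub` (additivity); `U₀` `G`-valued with (52) `pdev U₀ < α₀L^{−2k}`,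
`C₀α₀ ≤ ⅓`, `2α₀ ≤ c′₂`, `2α₀ ≤ βmax`; `U′ = e^{B}`, `sup‖B‖ ≤ b`; `e^{4cα₀}(1 + 8C₁Lᵏb) ≤ 2`; `2Lʲb ≤ c₃` for `j < k`) plus the
explicit smallness `2048(d+1)(d+4)L²α₀ ≤ 1`, `256(d+1)Lᵏb ≤ 1`, `8·C₁(d)·Lᵏb ≤ 1` (`C₁(d) = B7Prop3Flat.C1 d`, the threshold of
`B7Prop6General`).  CONCLUSION: at every bond `c` of `Ω^{(k)}`, `‖Ūᵏ(c)(Ū₀ᵏ(c))⁻¹ − 1‖ ≤ 200(d+1)·Lᵏb` (`Ūᵏ = avgIter L (e^{B}U₀) k`).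
PROOF: (131) for all levels from `prop4_general_of_prop3`; the levels `Ū₀ʲ` are `G`-valued with `pdev < 2α₀(Lʲ/Lᵏ)² ≤ 2α₀`
(`level_regularity`, Prop. 2); hence `U̿′ʲ = e^{Q_j}` (§1) and `B7Prop6General.prop6_general` applies.
[cite: Balaban1985Averaging, Prop. 6 (164) p.43, (161) p.42, (131) p.38, (52) p.26] -/
theorem prop6_general_of_prop3 (L : ℕ) (hL : 2 ≤ L) {G : Subgroup 𝔸ˣ} (hG : AvgClosed d L G)
    {C₁ c₃ c βmax : ℝ} (hC₁ : 0 ≤ C₁) (hc : 0 ≤ c)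
    (h3rem : ∀ (V₀ : Site d → Fin d → 𝔸ˣ) (β : ℝ), (∀ x κ, V₀ x κ ∈ G) → 0 ≤ β → pdev V₀ < β →
      β ≤ βmax → ∀ (A : Site d → Fin d → 𝔸) (a : ℝ), 0 ≤ a → a ≤ c₃ → (∀ x κ, ‖A x κ‖ ≤ a) →
      ∀ q κ, ‖Qcov L V₀ A q κ - linQcov L V₀ A q κ‖ ≤ C₁ * (L : ℝ) ^ 2 * a ^ 2)
    (h3lin : ∀ (V₀ : Site d → Fin d → 𝔸ˣ) (β : ℝ), (∀ x κ, V₀ x κ ∈ G) → 0 ≤ β → pdev V₀ < β →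
      β ≤ βmax → ∀ (A : Site d → Fin d → 𝔸) (a : ℝ), 0 ≤ a → (∀ x κ, ‖A x κ‖ ≤ a) →
      ∀ q κ, ‖linQcov L V₀ A q κ‖ ≤ L * (1 + c * (L : ℝ) ^ 2 * β) * a)
    (h3sub : ∀ (V₀ : Site d → Fin d → 𝔸ˣ) (β : ℝ), (∀ x κ, V₀ x κ ∈ G) → 0 ≤ β → pdev V₀ < β →
      β ≤ βmax → ∀ (A A' : Site d → Fin d → 𝔸) (q : Site d) (κ : Fin d),
      linQcov L V₀ (A - A') q κ = linQcov L V₀ A q κ - linQcov L V₀ A' q κ)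
    (k : ℕ) (U₀ : Site d → Fin d → 𝔸ˣ) (hU₀ : ∀ x κ, U₀ x κ ∈ G) {α₀ : ℝ} (hα : 0 < α₀)
    (hα3 : C0 d * α₀ ≤ 1 / 3) (hα2 : 2 * α₀ ≤ c2' d L) (h52 : pdev U₀ < α₀ * (((L : ℝ) ^ k)⁻¹) ^ 2)
    (hβmax : 2 * α₀ ≤ βmax)
    (B : Site d → Fin d → 𝔸) {b : ℝ} (hb : 0 ≤ b) (hB : ∀ x κ, ‖B x κ‖ ≤ b)
    (hsmall : Real.exp (4 * c * α₀) * (1 + 8 * C₁ * ((L : ℝ) ^ k * b)) ≤ 2)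
    (hc₃ : ∀ j < k, 2 * ((L : ℝ) ^ j * b) ≤ c₃)
    (hα₀s : 2048 * ((d : ℝ) + 1) * ((d : ℝ) + 4) * (L : ℝ) ^ 2 * α₀ ≤ 1)
    (hbs : 256 * ((d : ℝ) + 1) * ((L : ℝ) ^ k * b) ≤ 1) (hk : 8 * C1 d * ((L : ℝ) ^ k * b) ≤ 1)
    (z : Site d) (κ : Fin d) :
    ‖((avgIter L (expCfg B * U₀) k z κ : 𝔸ˣ) : 𝔸) * (((avgIter L U₀ k z κ)⁻¹ : 𝔸ˣ) : 𝔸) - 1‖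
      ≤ 200 * ((d : ℝ) + 1) * ((L : ℝ) ^ k * b) := by
  have hL1 : 1 ≤ L := le_trans (by norm_num) hL
  have hL1r : (1 : ℝ) ≤ L := by exact_mod_cast hL1
  -- (131) at every level
  have h4 := prop4_general_of_prop3 L hL hG hC₁ hc h3rem h3lin h3sub k U₀ hU₀ hα hα3 hα2 h52 hβmax B hb hB hsmall hc₃
  have h131 : ∀ j ≤ k, ∀ (z : Site d) (κ : Fin d), ‖logCovIter L U₀ B j z κ‖ ≤ 2 * ((L : ℝ) ^ j * b) :=
    fun j hj => (h4 j hj).2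
  -- the levels are `G`-valued and regular (Prop. 2)
  have hreg := level_regularity L hL hG k U₀ hU₀ hα hα3 hα2 h52
  have hV : ∀ j ≤ k, ∀ (x : Site d) (κ : Fin d), avgIter L U₀ j x κ ∈ U1 𝔸 :=
    fun j hj x κ => hG.le_U1 ((hreg j hj).2 x κ)
  have hpdev : ∀ j < k, pdev (avgIter L U₀ j) ≤ 2 * α₀ := by
    intro j hj
    have hLk : (0 : ℝ) < (L : ℝ) ^ k := by positivity
    have hratio : (L : ℝ) ^ j * ((L : ℝ) ^ k)⁻¹ ≤ 1 := by
      rw [mul_inv_le_iff₀ hLk, one_mul]; exact pow_le_pow_right₀ hL1r hj.le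
    have hratio0 : 0 ≤ (L : ℝ) ^ j * ((L : ℝ) ^ k)⁻¹ := by positivity
    have h1 : ((L : ℝ) ^ j * ((L : ℝ) ^ k)⁻¹) ^ 2 ≤ 1 := by
      rw [← one_pow 2]; exact pow_le_pow_left₀ hratio0 hratio 2
    have h2 : α₀ * ((L : ℝ) ^ j * ((L : ℝ) ^ k)⁻¹) ^ 2 ≤ α₀ := by
      have := mul_le_mul_of_nonneg_left h1 hα.le; linarith
    linarith [(hreg j hj.le).1]
  have hβ : 1024 * ((d : ℝ) + 1) * ((d : ℝ) + 4) * (L : ℝ) ^ 2 * (2 * α₀) ≤ 1 := by linarith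
  -- `U̿′ʲ = e^{Q_j}`
  have hQ := dbavgCovIter_eq_expCfg_logCovIter hL1 hb (fun j hj => hV j hj.le) (by linarith) hpdev hβ
    (fun j hj => h131 j hj.le) hbs
  exact (prop6_general hL hb hV (logCovIter L U₀ B) hQ h131 hk z κ).2.2.2.2

/-! ## §3 Proposition 6 at a general background — UNCONDITIONAL (the Prop.-3 binders supplied by `B7Eq123General`) -/

/-- **PROPOSITION 6 (159)/(161)/(163)/(164) AT A GENERAL BACKGROUND, k-UNIFORM, `O(1) = 200(d+1)` — KERNEL, UNCONDITIONAL**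
(p. 43: "**Proposition 6.** If `U₀` satisfies (52), then … `|\overline{U′U₀}ᵏ(Ūᵏ₀)⁻¹ − 1| < O(1)α₁`. (164)"; p. 42 (161):
"From Proposition 4, and especially from (131), we get `|(1/i) log U̿′ʲ| = |Q_j(U₀, ηA′)| < 2α₁Lʲη`").  HYPOTHESES = those of
`B7Eq123General.prop4_general` VERBATIM (seat p06's Literature-side certification of (123)/(130)–(131) at a general background):
`L ≥ 2`; `U₀` with values in an averaging-closed subgroup `G ⊂ U1` (`AvgClosed`) and (52) `pdev U₀ < α₀L^{−2k}`, `C₀α₀ ≤ ⅓`,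
`4α₀ ≤ c₂′(d,L)`; `U′ = e^{B}` with `sup‖B‖ ≤ b` (`b` plays `ηα₁`); smallness `e^{4cα₀}(1 + 8C₁Lᵏb) ≤ 2` with `c = 800(d+1)²(d+4)`,
`C₁ = 131072(d+1)²` ((131)) and `2Lᵏb ≤ c₃(d,L)` («α₁ ≦ ½c₃»).  CONCLUSION at every bond `c = ⟨z, z + e_κ⟩` of `Ω^{(k)}`, with
`Q_k = B7Prop4GeneralLevels.logCovIter L U₀ B k` and the accumulated covariant frame `v_k = B7Eq92Concrete.vcov`:
(159) `Ūᵏ(c)(Ū₀ᵏ(c))⁻¹ = v_k(c₋)·e^{Q_k(c)}·R(Ū₀ᵏ(c))(v_k(c₊)⁻¹)`; (161) `‖Q_k(c)‖ ≤ 2Lᵏb`; (163) `‖v_k(c₋) − 1‖ ≤ 64d·Lᵏb`,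
`‖v_k(c₊)⁻¹ − 1‖ ≤ 128d·Lᵏb`; (164) `‖Ūᵏ(c)(Ū₀ᵏ(c))⁻¹ − 1‖ ≤ 200(d+1)·Lᵏb` — all constants independent of `k`.
PROOF = print's: (131) at every level and `U̿′ʲ = e^{Q_j}` from `B7Eq123General.prop4_general` /
`B7Eq123General.dbavgCovIter_eq_expCfg_logCovIter`; the level backgrounds `Ū₀ʲ` are `U1`-valued (`B7Eq123General.level_data`,
Prop. 2); the threshold `8C₁(d)Lᵏb ≤ 1` of `B7Prop6General.prop6_general` (`C₁(d) = B7Prop3Flat.C1 d = 1256(d+1)²`) follows from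
`hsmall` since `1256 ≤ 131072` and `e^{4cα₀} ≥ 1`; then `B7Prop6General.prop6_general`.  (§2 `prop6_general_of_prop3` is the same
assembly with the Prop.-3 binders displayed; §3 discharges them through p06's file.)  NOT CLAIMED: the analyticity clause of
Prop. 6 at a general background. [cite: Balaban1985Averaging, Proposition 6 (164) p.43, (159)–(161), (163) p.42, (131) p.38, (52) p.26] -/
theorem prop6_general_unconditional (L : ℕ) (hL : 2 ≤ L) {G : Subgroup 𝔸ˣ} (hG : AvgClosed d L G) (k : ℕ)
    (U₀ : Site d → Fin d → 𝔸ˣ) (hU₀ : ∀ x κ, U₀ x κ ∈ G) {α₀ : ℝ} (hα : 0 < α₀)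
    (hα3 : C0 d * α₀ ≤ 1 / 3) (hα4 : 4 * α₀ ≤ c2' d L) (h52 : pdev U₀ < α₀ * (((L : ℝ) ^ k)⁻¹) ^ 2)
    (B : Site d → Fin d → 𝔸) {b : ℝ} (hb : 0 ≤ b) (hB : ∀ x κ, ‖B x κ‖ ≤ b)
    (hsmall : Real.exp (4 * (800 * ((d : ℝ) + 1) ^ 2 * ((d : ℝ) + 4)) * α₀)
      * (1 + 8 * (131072 * ((d : ℝ) + 1) ^ 2) * ((L : ℝ) ^ k * b)) ≤ 2)
    (hc₃ : 2 * ((L : ℝ) ^ k * b) ≤ c3 d L) (z : Site d) (κ : Fin d) :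
    ((avgIter L (expCfg B * U₀) k z κ : 𝔸ˣ) : 𝔸) * (((avgIter L U₀ k z κ)⁻¹ : 𝔸ˣ) : 𝔸)
        = (vcov L U₀ (expCfg B) k z : 𝔸) * exp (logCovIter L U₀ B k z κ) *
            ((avgIter L U₀ k z κ : 𝔸) * (((vcov L U₀ (expCfg B) k (z + e κ))⁻¹ : 𝔸ˣ) : 𝔸) *
              (((avgIter L U₀ k z κ)⁻¹ : 𝔸ˣ) : 𝔸)) ∧
      ‖logCovIter L U₀ B k z κ‖ ≤ 2 * ((L : ℝ) ^ k * b) ∧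
      ‖(vcov L U₀ (expCfg B) k z : 𝔸) - 1‖ ≤ 64 * d * ((L : ℝ) ^ k * b) ∧
      ‖(((vcov L U₀ (expCfg B) k (z + e κ))⁻¹ : 𝔸ˣ) : 𝔸) - 1‖ ≤ 128 * d * ((L : ℝ) ^ k * b) ∧
      ‖((avgIter L (expCfg B * U₀) k z κ : 𝔸ˣ) : 𝔸) * (((avgIter L U₀ k z κ)⁻¹ : 𝔸ˣ) : 𝔸) - 1‖
        ≤ 200 * ((d : ℝ) + 1) * ((L : ℝ) ^ k * b) := by
  -- (131) at every level, `U̿′ʲ = e^{Q_j}`, and the `U1`-valued level backgrounds — all from `B7Eq123General`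
  have h4 := B7Eq123General.prop4_general L hL hG k U₀ hU₀ hα hα3 hα4 h52 B hb hB hsmall hc₃
  have h131 : ∀ j ≤ k, ∀ (z : Site d) (κ : Fin d), ‖logCovIter L U₀ B j z κ‖ ≤ 2 * ((L : ℝ) ^ j * b) :=
    fun j hj => (h4 j hj).2
  have hV : ∀ j ≤ k, ∀ (x : Site d) (κ : Fin d), avgIter L U₀ j x κ ∈ U1 𝔸 :=
    fun j hj => (B7Eq123General.level_data L hL hG k U₀ hU₀ hα hα3 hα4 h52 j hj).1
  have hQ := B7Eq123General.dbavgCovIter_eq_expCfg_logCovIter L hL hG k U₀ hU₀ hα hα3 hα4 h52 B hb hB hsmall hc₃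
  -- the threshold `8C₁(d)Lᵏb ≤ 1` of `prop6_general` from `hsmall`
  have hk : 8 * C1 d * ((L : ℝ) ^ k * b) ≤ 1 := by
    have ht : 0 ≤ (L : ℝ) ^ k * b := by positivity
    have hexp : 1 ≤ Real.exp (4 * (800 * ((d : ℝ) + 1) ^ 2 * ((d : ℝ) + 4)) * α₀) := by
      have h := Real.add_one_le_exp (4 * (800 * ((d : ℝ) + 1) ^ 2 * ((d : ℝ) + 4)) * α₀)
      have : 0 ≤ 4 * (800 * ((d : ℝ) + 1) ^ 2 * ((d : ℝ) + 4)) * α₀ := by positivity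
      linarith
    have h0 : 0 ≤ 1 + 8 * (131072 * ((d : ℝ) + 1) ^ 2) * ((L : ℝ) ^ k * b) := by positivity
    have h1 : 1 + 8 * (131072 * ((d : ℝ) + 1) ^ 2) * ((L : ℝ) ^ k * b) ≤ 2 := by
      have h2 := mul_le_mul_of_nonneg_right hexp h0
      linarith
    have hC : C1 d ≤ 131072 * ((d : ℝ) + 1) ^ 2 := by
      unfold C1; nlinarith [sq_nonneg ((d : ℝ) + 1)]
    have h3 := mul_le_mul_of_nonneg_right hC (by positivity : (0 : ℝ) ≤ 8 * ((L : ℝ) ^ k * b))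
    nlinarith
  exact prop6_general hL hb hV (logCovIter L U₀ B) hQ h131 hk z κ

/-- **(164) AT A GENERAL BACKGROUND, k-UNIFORM, UNCONDITIONAL** — the last clause of `prop6_general_unconditional`:
under the hypotheses of `B7Eq123General.prop4_general`, `‖Ūᵏ(c)(Ū₀ᵏ(c))⁻¹ − 1‖ ≤ 200(d+1)·Lᵏb` at every bond of `Ω^{(k)}`
(`Ūᵏ = avgIter L (e^{B}U₀) k`; print: "`|\overline{U′U₀}ᵏ(Ūᵏ₀)⁻¹ − 1| < O(1)α₁`", `b = ηα₁`, `Lᵏη = 1`).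
[cite: Balaban1985Averaging, Proposition 6 (164) p.43] -/
theorem eq164_general_unconditional (L : ℕ) (hL : 2 ≤ L) {G : Subgroup 𝔸ˣ} (hG : AvgClosed d L G) (k : ℕ)
    (U₀ : Site d → Fin d → 𝔸ˣ) (hU₀ : ∀ x κ, U₀ x κ ∈ G) {α₀ : ℝ} (hα : 0 < α₀)
    (hα3 : C0 d * α₀ ≤ 1 / 3) (hα4 : 4 * α₀ ≤ c2' d L) (h52 : pdev U₀ < α₀ * (((L : ℝ) ^ k)⁻¹) ^ 2)
    (B : Site d → Fin d → 𝔸) {b : ℝ} (hb : 0 ≤ b) (hB : ∀ x κ, ‖B x κ‖ ≤ b)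
    (hsmall : Real.exp (4 * (800 * ((d : ℝ) + 1) ^ 2 * ((d : ℝ) + 4)) * α₀)
      * (1 + 8 * (131072 * ((d : ℝ) + 1) ^ 2) * ((L : ℝ) ^ k * b)) ≤ 2)
    (hc₃ : 2 * ((L : ℝ) ^ k * b) ≤ c3 d L) (z : Site d) (κ : Fin d) :
    ‖((avgIter L (expCfg B * U₀) k z κ : 𝔸ˣ) : 𝔸) * (((avgIter L U₀ k z κ)⁻¹ : 𝔸ˣ) : 𝔸) - 1‖
      ≤ 200 * ((d : ℝ) + 1) * ((L : ℝ) ^ k * b) :=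
  (prop6_general_unconditional L hL hG k U₀ hU₀ hα hα3 hα4 h52 B hb hB hsmall hc₃ z κ).2.2.2.2

end Literature.MathematicalPhysics.QuantumFieldTheory.Balaban1983to89.B7Prop6GeneralLevels
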